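import Mathlib.AlgebraicGeometry.IdealSheaf.Functorial
import Mathlib.AlgebraicGeometry.Morphisms.SchemeTheoreticallyDominant
import Mathlib.AlgebraicGeometry.Morphisms.ClosedImmersion
import Mathlib.AlgebraicGeometry.Morphisms.Flat
import Mathlib.AlgebraicGeometry.Morphisms.Preimmersion
import HarnessLib

/-!
# The generic fibre of a scheme-theoretic closure (scheme-theoretic image and flat monomorphic base change)

Let `i : S' → S` be a flat monomorphism of schemes — the case of interest is
`Spec K → Spec R` for a domain `R` with fraction field (or any localization) `K` — and let
`P' = P ×_S S'`. For a closed subscheme `X ⊆ P'` let `𝒳 ⊆ P` be the scheme-theoretic image of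
`X → P' → P` ("the closure of `X` in `P`"). We prove `X = 𝒳 ×_S S'`
(`Literature.AlgebraicGeometry.Motives.isPullback_toImage_of_flat_mono`): the generic fibre of the closure of `X` is `X`.
This is the special case of "formation of the scheme-theoretic image commutes with flat base
change" (Stacks, Tag 081I) along a flat monomorphism, which is what the spreading-out theorem
(`Literature.AlgebraicGeometry.Motives.GoodReductionProofs`) needs; we deduce it from Mathlib's
`IsSchemeTheoreticallyDominant.pullbackSnd` (scheme-theoretic dominance is preserved by flat
base change): the comparison map `X → 𝒳 ×_S S'` is a closed immersion and is, up to the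
isomorphism `X ×_𝒳 (𝒳 ×_S S') ≅ X ×_S S' ≅ X` (as `i` is a monomorphism through which `X → S`
factors), the base change of the scheme-theoretically dominant `X → 𝒳`; a scheme-theoretically
dominant closed immersion is an isomorphism.

## Main results

* `Literature.AlgebraicGeometry.Motives.isSchemeTheoreticallyDominant_toImage`: `X → im(f)` is scheme-theoretically
  dominant for `f` quasi-compact (Stacks, Tag 01R8).
* `Literature.AlgebraicGeometry.Motives.isPullback_toImage_of_flat_mono`: the cartesian square above (Stacks, Tag 081I,
  flat monomorphism case).
* `Literature.AlgebraicGeometry.Motives.flat_specMap_of_isLocalization`, `Literature.AlgebraicGeometry.Motives.mono_specMap_of_isLocalization`: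
  `Spec S⁻¹R → Spec R` is flat and a monomorphism (Mathlib: localizations are flat, and
  `Spec` of a localization is a preimmersion).

## References

* The Stacks project, Tags 01R8 (scheme-theoretic image of a quasi-compact morphism),
  081I (flat base change of scheme-theoretic images). [StacksProject]
* A. Grothendieck, EGA IV₂ 2.3.2, IV₃ 8.10 (closure of the generic fibre).
-/
universe u

open CategoryTheory AlgebraicGeometry Limits

noncomputable section

namespace Literature.AlgebraicGeometry.Motives

variable {X Y Z : Scheme.{u}}

/-- The canonical morphism `X → im(f)` to the scheme-theoretic image of a quasi-compact morphism
`f : X → Y` is scheme-theoretically dominant, i.e. its kernel ideal sheaf vanishes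
(`𝒪_{im f} → f_*𝒪_X` is injective; Stacks, Tag 01R8: `im(f)` is cut out by
`Ker(𝒪_Y → f_*𝒪_X)`). Proof: the closed subscheme `Z ⊆ im(f)` cut out by `ker (X → im(f))`
is a closed subscheme of `Y` with the same kernel as `im(f) ↪ Y` (Mathlib
`Scheme.IdealSheafData.map_ker`), so `Z = im(f)` (`IsClosedImmersion.isIso_of_ker_eq`).
[cite: StacksProject, Tag 01R8] -/
theorem isSchemeTheoreticallyDominant_toImage (f : X ⟶ Y) [QuasiCompact f] :
    IsSchemeTheoreticallyDominant f.toImage := by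
  refine ⟨?_⟩
  set I := f.toImage.ker with hI
  have hmap : I.map f.imageι = f.ker := by
    rw [hI, Scheme.IdealSheafData.map_ker, Scheme.Hom.toImage_imageι]
  have hker : (I.subschemeι ≫ f.imageι).ker = f.imageι.ker := by
    change I.map f.imageι = _
    rw [hmap, Scheme.IdealSheafData.ker_subschemeι]
  haveI : IsIso I.subschemeι :=
    IsClosedImmersion.isIso_of_ker_eq (I.subschemeι ≫ f.imageι) f.imageι I.subschemeι rfl hker
  exact (Scheme.isIso_subschemeι_iff_eq_bot I).mp inferInstance

/-- A closed immersion which is scheme-theoretically dominant is an isomorphism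
(Mathlib `IsClosedImmersion.isIso_iff_ker_eq_bot`). [folklore] -/
theorem isIso_of_isClosedImmersion_of_isSchemeTheoreticallyDominant (f : X ⟶ Y)
    [IsClosedImmersion f] [IsSchemeTheoreticallyDominant f] : IsIso f :=
  IsClosedImmersion.isIso_iff_ker_eq_bot.mpr (IsSchemeTheoreticallyDominant.ker_eq_bot f)

/-- For a monomorphism `m : S' → S` and `a : X → S'`, the square `(𝟙_X, a; a ≫ m, m)` is
cartesian: `X ×_S S' = X` when `X → S` factors through the monomorphism `S' → S`. [folklore] -/
theorem isPullback_id_of_mono {C : Type*} [Category C] {X S S' : C} (a : X ⟶ S') (m : S' ⟶ S)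
    [Mono m] : IsPullback a (𝟙 X) m (a ≫ m) :=
  IsPullback.of_vert_isIso_mono ⟨by simp⟩

section Main

variable {S S' P P' : Scheme.{u}} (i : S' ⟶ S) [Flat i] [Mono i]
  (p : P ⟶ S) (p' : P' ⟶ S') (φ : P' ⟶ P)

/-- **Scheme-theoretic image and flat monomorphic base change (generic fibres).** Let
`i : S' → S` be a flat monomorphism (e.g. `Spec K → Spec R` for a domain `R` with fraction field
`K`), `P' = P ×_S S'` with projection `φ : P' → P`, and `ι : X ↪ P'` a closed immersion (so `X`
is an `S'`-scheme via `a = ι ≫ p'`). Let `𝒳 = im(ι ≫ φ) ⊆ P` be the scheme-theoretic image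
(the "closure of `X` in `P`"). Then `X = 𝒳 ×_S S'`, i.e. the square
`(X → 𝒳, a; 𝒳 → P → S, i)` is cartesian. Proof: the comparison `c : X → 𝒳 ×_S S'` is a closed
immersion (it lifts `ι` along the closed immersion `𝒳 ×_S S' ↪ P ×_S S' = P'`) and is
scheme-theoretically dominant (it is, up to the isomorphism `X ×_𝒳 (𝒳 ×_S S') ≅ X ×_S S' ≅ X`
coming from `i` being a monomorphism, the base change of the scheme-theoretically dominant
`X → 𝒳` along the flat `𝒳 ×_S S' → 𝒳`, Mathlib `IsSchemeTheoreticallyDominant.pullbackSnd`),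
hence an isomorphism. This is the case of Stacks, Tag 081I (formation of the scheme-theoretic
image commutes with flat base change) that we need. [cite: StacksProject, Tag 081I] -/
theorem isPullback_toImage_of_flat_mono (hP : IsPullback φ p' p i) (ι : X ⟶ P')
    [IsClosedImmersion ι] [QuasiCompact φ] (a : X ⟶ S') (hι : ι ≫ p' = a) :
    IsPullback (ι ≫ φ).toImage a ((ι ≫ φ).imageι ≫ p) i := by
  set g := ι ≫ φ with hg
  have w : g.toImage ≫ g.imageι ≫ p = a ≫ i := by
    rw [Scheme.Hom.toImage_imageι_assoc, hg, Category.assoc, hP.w, ← hι, Category.assoc]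
  let c : X ⟶ pullback (g.imageι ≫ p) i := pullback.lift g.toImage a w
  suffices IsIso c from
    IsPullback.of_iso_pullback ⟨w⟩ (asIso c) (pullback.lift_fst _ _ _) (pullback.lift_snd _ _ _)
  -- `c` is a closed immersion
  have h1 : IsClosedImmersion c := by
    let m₁ : pullback (g.imageι ≫ p) i ⟶ P' :=
      hP.lift (pullback.fst _ _ ≫ g.imageι) (pullback.snd _ _)
        (by rw [Category.assoc, pullback.condition])
    have hm₁φ : m₁ ≫ φ = pullback.fst _ _ ≫ g.imageι := hP.lift_fst _ _ _
    have hm₁p' : m₁ ≫ p' = pullback.snd _ _ := hP.lift_snd _ _ _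
    have hsq : IsPullback m₁ (pullback.fst (g.imageι ≫ p) i) φ g.imageι := by
      refine IsPullback.of_right ?_ hm₁φ hP.flip
      rw [hm₁p']
      exact (IsPullback.of_hasPullback (g.imageι ≫ p) i).flip
    haveI : IsClosedImmersion m₁ := MorphismProperty.of_isPullback hsq.flip inferInstance
    have hc : c ≫ m₁ = ι := by
      refine hP.hom_ext ?_ ?_
      · rw [Category.assoc, hm₁φ, pullback.lift_fst_assoc, Scheme.Hom.toImage_imageι]
      · rw [Category.assoc, hm₁p', pullback.lift_snd, hι]
    haveI : IsClosedImmersion (c ≫ m₁) := by rw [hc]; infer_instance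
    exact IsClosedImmersion.of_comp_isClosedImmersion c m₁
  -- `c` is scheme-theoretically dominant
  have h2 : IsSchemeTheoreticallyDominant c := by
    haveI : IsSchemeTheoreticallyDominant g.toImage := isSchemeTheoreticallyDominant_toImage g
    set fst₁ := pullback.fst (g.imageι ≫ p) i
    set snd₁ := pullback.snd (g.imageι ≫ p) i
    haveI : Flat fst₁ := MorphismProperty.pullback_fst _ _ inferInstance
    let fst' := pullback.fst g.toImage fst₁
    let snd' := pullback.snd g.toImage fst₁
    have H : IsPullback (snd' ≫ snd₁) fst' i (a ≫ i) := by
      rw [← w]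
      exact (IsPullback.of_hasPullback g.toImage fst₁).flip.paste_horiz
        (IsPullback.of_hasPullback (g.imageι ≫ p) i).flip
    have H₀ : IsPullback a (𝟙 X) i (a ≫ i) := isPullback_id_of_mono a i
    have hfst' : fst' = (H.isoIsPullback _ _ H₀).hom := by
      simpa using (H.isoIsPullback_hom_snd _ _ H₀).symm
    haveI : IsIso fst' := by rw [hfst']; infer_instance
    let s : X ⟶ pullback g.toImage fst₁ :=
      pullback.lift (𝟙 X) c (by rw [Category.id_comp]; exact (pullback.lift_fst _ _ _).symm)
    have hs : s = inv fst' := by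
      rw [← Category.comp_id s, ← IsIso.hom_inv_id fst', ← Category.assoc, pullback.lift_fst,
        Category.id_comp]
    haveI : IsIso s := by rw [hs]; infer_instance
    have hcs : c = s ≫ snd' := (pullback.lift_snd _ _ _).symm
    rw [hcs]
    infer_instance
  exact isIso_of_isClosedImmersion_of_isSchemeTheoreticallyDominant c

end Main

/-! ### The case `Spec K → Spec R`, `K` a localization (e.g. the fraction field) of `R` -/

section Localization

variable (R K : Type u) [CommRing R] [CommRing K] [Algebra R K]

/-- `Spec S⁻¹R → Spec R` is flat. [folklore] -/
theorem flat_specMap_of_isLocalization (M : Submonoid R) [IsLocalization M K] :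
    Flat (Spec.map (CommRingCat.ofHom (algebraMap R K))) := by
  rw [HasRingHomProperty.Spec_iff (P := @Flat)]
  change (algebraMap R K).Flat
  rw [RingHom.flat_algebraMap_iff]
  exact IsLocalization.flat K M

/-- `Spec S⁻¹R → Spec R` is a preimmersion (Mathlib), hence a monomorphism. [folklore] -/
theorem mono_specMap_of_isLocalization (M : Submonoid R) [IsLocalization M K] :
    Mono (Spec.map (CommRingCat.ofHom (algebraMap R K))) :=
  haveI := IsPreimmersion.of_isLocalization (R := R) (S := K) M
  inferInstance

end Localization

end Literature.AlgebraicGeometry.Motives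

end
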